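/-
Copyright: harness tree, Literature layer (sorry-free). b2b-lace enum1-g51 (ENUMERATION SHARD A gen 51),
node KU-SEP, leaf KU-SEP-SEED, slice K1: the TWISTED seed-certificate evaluator (computable layer).
What-if / input-certification lane; d-parametric; no statement at any fixed dimension.
-/
import Literature.Probability.FitznerVanDerHofstad2017.SrwSeedCertKernelD
import HarnessLib

/-!
# Twisted SEEDCERT kernel evaluator, computable layer: Gaussian-integer EGF powers, Poisson block, ball-form Bessel tail

This file is the COMPUTABLE half of the certificate evaluator for the finite Bessel-row objects of the
cosine-twisted SRW integrals (Fitzner–van der Hofstad [NoBLE17, §5.1.1 (5.2)–(5.5)], twisted axis rows: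
`e^{-τ} ∏_μ I_{x_μ}` with one coordinate replaced by the two-sided Bessel row `Σ_j ε_j I_{jm}(τ/d) c_j`,
`c_j = 2π i^j q_j`):

`RowObj d n' m J q = (1/n'!) ∫₀^∞ τ^{n'} e^{-τ} Re(Σ_{j ≤ J} ε_j I_{jm}(τ/d) · 2π i^j q_j)^d dτ / (2π)^d`
`= (d^{n'+1}/n'!) ∫₀^∞ u^{n'} Re Ψ(u)^d du`, `Ψ(u) = Σ_{j ≤ J} ε_j i^j q_j q_u(jm)`, `q_u(a) = e^{-u} I_a(u)`,

for a literal rational row `q_j = Q_j/qden` with `|q_j| ≤ 1`.  It is the twisted analogue of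
`SrwSeedCertKernel` / `SrwSeedCertKernelD` (whose list kernels it reuses) with three changes:

* `[0,T]` (Poisson) block: the walk-count hat table is replaced by the GAUSSIAN-INTEGER EGF POWER
  TABLE `Θ_p(N) = (M̂!/N!) · qden^p · τ_p(N)`, `τ_1(N) = Σ_j ε_j i^j Q_j · walk1 N (jm)` (twisted
  one-dimensional counts), `τ_{p+q}(N) = Σ_{a+b=N} C(N,a) τ_p(a) τ_q(b)` (so that
  `Σ_N τ_d(N) s^N/N! = qden^d Φ(2s)^d`, `Φ(v) = Σ_j ε_j i^j q_j I_{jm}(v)`), computed by BINARY POWERING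
  (`O(log d)` truncated products) on PARITY-SPLIT coefficient lists (`R(s) = A(s²) + i s^σ B(s²)`,
  `σ = m mod 2`: real part on even exponents, imaginary part on exponents `≡ σ`), every list a pair
  (positive part, negative part) of `ℕ` lists, normalised entrywise before the exact division by `M̂!`;
  the N-remainder of the block is TWO-SIDED, `|R| ≤ R⁺` (`|τ_d(N)| ≤ qden^d (2d)^N` needs only `|q_j| ≤ 1`);
* `[T,∞)` block in BALL form: per order `a` the bracket `√(2πu) q_u(a) = Mid_a(w) ± ε_a w^{J_b+1}`
  (`w = 1/u`; `mcoef`, `epsBoundQ` of `SrwSeedCertKernel`) gives `√(2πu) Ψ(u) = P(w) + E`,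
  `P = Σ_j ε_j i^j q_j Mid_{jm} ∈ ℚ[i][w]`, `|E| ≤ ρ w^{J_b+1}`; the block is
  `(2π)^{-d/2} (∫_T^∞ u^{n'-d/2} Re P(1/u)^d du + θ ∫_T^∞ u^{n'-d/2} B(1/u) du)`, `|θ| ≤ 1`,
  `B(w) = (α U_0(w) + 2ρ w^{J_b+1})^d - (α U_0(w) + ρ w^{J_b+1})^d` (`|Re(P+E)^d - Re P^d| ≤ (|P|+|E|)^d - |P|^d`,
  `|P| ≤ α U_0 + ρ w^{J_b+1}` pointwise, `U_0` = the upper bracket polynomial of order `0`, `α ≥ Σ ε_j|q_j|`,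
  `ρ ≥ Σ_j ε_j |q_j| ε_{jm}`) — no positivity floor, hence no order ceiling from the sign path;
* the assembly is sign-aware (`U_n`, the tail main term and `e^{-λ} U_n` may be negative).

Everything here is a `def`; the soundness theorem (`SrwTwistSeedCertSound`) turns `TwCert.checkT c D = true`
into `c.lo n ≤ RowObj D (n-1) m J q ≤ c.hi n`.  [cite: FitznerVanDerHofstad2016NoBLE, §5.1.1 (5.2)–(5.5) pp. 1089–1090]
-/

namespace Literature.Probability.FitznerVanDerHofstad2017.SeedCert

open Finset

/-! ### Packed products (Kronecker substitution)

A truncated Cauchy product of two coefficient lists is computed as ONE product of natural numbers: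
with a base `2^b` exceeding every coefficient of the product, `Σ_i u_i 2^{bi} · Σ_j v_j 2^{bj} = Σ_k (u⋆v)_k 2^{bk}`
and the coefficients are read off as base-`2^b` digits (masks and shifts).  The kernel's GMP arithmetic then does the
`O(L²)` work inside a single `Nat.mul`, instead of `O(L²)` separately cached big-number operations
(which is what bounds the plain list kernels: memory, not time).  Packing and digit extraction are
balanced binary splits (`2^j` digits), so that the intermediate numbers total `O(L log L)` digits. -/

/-- Maximum entry (accumulator form). [folklore] -/
def maxNAux : List ℕ → ℕ → ℕ
  | [], m => m
  | x :: xs, m => maxNAux xs (if m ≤ x then x else m)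

/-- Maximum entry of an `ℕ` list (`0` for `[]`). [folklore] -/
def maxN (l : List ℕ) : ℕ := maxNAux l 0

/-- `packT b j l = Σ_{i < 2^j} l_i 2^{b i}` (balanced splitting; `l` of length `≤ 2^j`, missing entries
`0`). [folklore] -/
def packT (b : ℕ) : ℕ → List ℕ → ℕ
  | 0, l => l.headD 0
  | j + 1, l => packT b j (l.take (2 ^ j)) + packT b j (l.drop (2 ^ j)) <<< (b * 2 ^ j)

/-- The `2^j` low base-`2^b` digits of `N` (little-endian; exact when `N < 2^{b 2^j}`), by balanced
splitting with masks and shifts. [folklore] -/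
def unpackT (b : ℕ) : ℕ → ℕ → List ℕ
  | 0, N => [N]
  | j + 1, N => unpackT b j (N &&& (2 ^ (b * 2 ^ j) - 1)) ++ unpackT b j (N >>> (b * 2 ^ j))

/-- `depthAux fuel j L` = the least `j' ≥ j` with `L ≤ 2^{j'}` (fuel-bounded search). [folklore] -/
def depthAux : ℕ → ℕ → ℕ → ℕ
  | 0, j, _ => j
  | fuel + 1, j, L => if L ≤ 2 ^ j then j else depthAux fuel (j + 1) L

/-- The least `j` with `L ≤ 2^j`. [folklore] -/
def depthOf (L : ℕ) : ℕ := depthAux L 0 L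

/-- **Packed truncated product**: the first `L` coefficients of `u ⋆ v` (zero-padded to length `L`),
exact when `u`, `v` have length `≤ L`: the digit width `b = log₂(Σu · max v) + 1` computed here bounds every
coefficient of the product (`(u⋆v)_k ≤ Σu · max v < 2^b`). [cite: FitznerVanDerHofstad2016NoBLE, §5.1.1 (5.4)–(5.5) pp. 1089–1090] -/
def pconv (L : ℕ) (u v : List ℕ) : List ℕ :=
  let j := depthOf L
  let b := Nat.log2 (lsumN u * maxN v) + 1
  (unpackT b j ((packT b j u * packT b j v) &&& (2 ^ (b * L) - 1))).take L

/-! ### Signed coefficient lists as (positive part, negative part) pairs of `ℕ` lists -/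

/-- Product of two signed lists `(p⁺,p⁻)·(q⁺,q⁻)`, first `L` coefficients (packed products):
`(p⁺q⁺ + p⁻q⁻, p⁺q⁻ + p⁻q⁺)`. [cite: FitznerVanDerHofstad2016NoBLE, §5.1.1 (5.4)–(5.5) pp. 1089–1090] -/
def mulPN (p q : List ℕ × List ℕ) (L : ℕ) : List ℕ × List ℕ :=
  (zipAddN (pconv L p.1 q.1) (pconv L p.2 q.2), zipAddN (pconv L p.1 q.2) (pconv L p.2 q.1))

/-- Sum of two signed lists. [cite: FitznerVanDerHofstad2016NoBLE, §5.1.1 (5.4)–(5.5) pp. 1089–1090] -/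
def addPN (p q : List ℕ × List ℕ) : List ℕ × List ℕ := (zipAddN p.1 q.1, zipAddN p.2 q.2)

/-- Difference of two signed lists. [cite: FitznerVanDerHofstad2016NoBLE, §5.1.1 (5.4)–(5.5) pp. 1089–1090] -/
def subPN (p q : List ℕ × List ℕ) : List ℕ × List ℕ := (zipAddN p.1 q.2, zipAddN p.2 q.1)

/-- Multiplication by `X^σ`, truncated to `L` coefficients. [cite: FitznerVanDerHofstad2016NoBLE, §5.1.1 (5.4)–(5.5) pp. 1089–1090] -/
def shiftPN (σ L : ℕ) (p : List ℕ × List ℕ) : List ℕ × List ℕ :=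
  ((List.replicate σ 0 ++ p.1).take L, (List.replicate σ 0 ++ p.2).take L)

/-- Entrywise truncated difference `p ∸ n` (the shorter list padded with `0`). [folklore] -/
def psubN : List ℕ → List ℕ → List ℕ
  | [], ns => List.replicate ns.length 0
  | p :: ps, [] => p :: ps
  | p :: ps, n :: ns => (p - n) :: psubN ps ns

/-- Entrywise normalisation `(p, n) ↦ (p ∸ n, n ∸ p)` (same value `p - n`, one of the two parts zero).
[cite: FitznerVanDerHofstad2016NoBLE, §5.1.1 (5.4)–(5.5) pp. 1089–1090] -/
def normPN (p : List ℕ × List ℕ) : List ℕ × List ℕ := (psubN p.1 p.2, psubN p.2 p.1)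

/-- Entrywise exact division of both parts by `Mf`. [cite: FitznerVanDerHofstad2016NoBLE, §5.1.1 (5.4)–(5.5) pp. 1089–1090] -/
def divPN (Mf : ℕ) (p : List ℕ × List ℕ) : List ℕ × List ℕ := (divRow Mf p.1, divRow Mf p.2)

/-- The zero signed list of length `L`. [cite: FitznerVanDerHofstad2016NoBLE, §5.1.1 (5.4)–(5.5) pp. 1089–1090] -/
def zeroPN (L : ℕ) : List ℕ × List ℕ := (List.replicate L 0, List.replicate L 0)

/-- Positive parts of an integer list. [folklore] -/
def posOfZ : List ℤ → List ℕ
  | [] => []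
  | (Int.ofNat k) :: zs => k :: posOfZ zs
  | (Int.negSucc _) :: zs => 0 :: posOfZ zs

/-- Negative parts of an integer list. [folklore] -/
def negOfZ : List ℤ → List ℕ
  | [] => []
  | (Int.ofNat _) :: zs => 0 :: negOfZ zs
  | (Int.negSucc k) :: zs => (k + 1) :: negOfZ zs

/-- `(pos, neg)` parts of an integer list. [cite: FitznerVanDerHofstad2016NoBLE, §5.1.1 (5.4)–(5.5) pp. 1089–1090] -/
def pnOfZ (zs : List ℤ) : List ℕ × List ℕ := (posOfZ zs, negOfZ zs)

/-- `c • (p⁺, p⁻)` for `c : ℕ`. [cite: FitznerVanDerHofstad2016NoBLE, §5.1.1 (5.4)–(5.5) pp. 1089–1090] -/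
def smulPN (c : ℕ) (p : List ℕ × List ℕ) : List ℕ × List ℕ := (smulN c p.1, smulN c p.2)

/-- Negation `(p⁺, p⁻) ↦ (p⁻, p⁺)`. [cite: FitznerVanDerHofstad2016NoBLE, §5.1.1 (5.4)–(5.5) pp. 1089–1090] -/
def negPN (p : List ℕ × List ℕ) : List ℕ × List ℕ := (p.2, p.1)

/-! ### Gaussian-integer coefficient lists: pairs (real part, imaginary part) of signed lists -/

/-- A Gaussian-integer coefficient list: `((re⁺, re⁻), (im⁺, im⁻))`. [cite: FitznerVanDerHofstad2016NoBLE, §5.1.1 (5.4)–(5.5) pp. 1089–1090] -/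
abbrev GZ := (List ℕ × List ℕ) × (List ℕ × List ℕ)

/-- **The parity-split Gaussian product with exact division.** For `X = (A, B)`, `Y = (C, D)` with
values `A(z) + i s^σ B(z)`, `C(z) + i s^σ D(z)` (`z = s²`, `σ ∈ {0,1}`) the product is
`(AC - z^σ BD) + i s^σ (AD + BC)`; every part truncated to `L` coefficients, normalised and divided
entrywise by `Mf`. [cite: FitznerVanDerHofstad2016NoBLE, §5.1.1 (5.4)–(5.5) pp. 1089–1090] -/
def gzMul (σ Mf L : ℕ) (X Y : GZ) : GZ :=
  let re := subPN (mulPN X.1 Y.1 L) (shiftPN σ L (mulPN X.2 Y.2 L))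
  let im := addPN (mulPN X.1 Y.2 L) (mulPN X.2 Y.1 L)
  (forcePN (divPN Mf (normPN re)), forcePN (divPN Mf (normPN im)))

/-- Binary powering with fuel: `gzPowAux σ Mf L R fuel p` = the `p`-th power of `R` (`1 ≤ p ≤ fuel + 1`;
each product followed by the exact division by `Mf`). [cite: FitznerVanDerHofstad2016NoBLE, §5.1.1 (5.4)–(5.5) pp. 1089–1090] -/
def gzPowAux (σ Mf L : ℕ) (R : GZ) : ℕ → ℕ → GZ
  | 0, _ => R
  | fuel + 1, p =>
      bif Nat.ble p 1 then R
      else bif p % 2 == 0 then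
        let H := gzPowAux σ Mf L R fuel (p / 2)
        gzMul σ Mf L H H
      else gzMul σ Mf L R (gzPowAux σ Mf L R fuel (p - 1))

/-- `R^p` by binary powering (see `gzPowAux`). [cite: FitznerVanDerHofstad2016NoBLE, §5.1.1 (5.4)–(5.5) pp. 1089–1090] -/
def gzPow (σ Mf L : ℕ) (R : GZ) (p : ℕ) : GZ := gzPowAux σ Mf L R p p

/-- The Gaussian product WITHOUT parity shift, truncation or division (polynomials in `w`; output
length `L` must be at least the full product length). [cite: FitznerVanDerHofstad2016NoBLE, §5.1.1 (5.4)–(5.5) pp. 1089–1090] -/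
def gzMulW (L : ℕ) (X Y : GZ) : GZ :=
  let re := subPN (mulPN X.1 Y.1 L) (mulPN X.2 Y.2 L)
  let im := addPN (mulPN X.1 Y.2 L) (mulPN X.2 Y.1 L)
  (forcePN (normPN re), forcePN (normPN im))

/-- `X^p` for `w`-polynomials by binary powering; `ℓ` = the length of `X` (so that `X^p` has length
`p(ℓ-1)+1`). [cite: FitznerVanDerHofstad2016NoBLE, §5.1.1 (5.4)–(5.5) pp. 1089–1090] -/
def gzPowWAux (ℓ : ℕ) (X : GZ) : ℕ → ℕ → GZ
  | 0, _ => X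
  | fuel + 1, p =>
      bif Nat.ble p 1 then X
      else bif p % 2 == 0 then
        let H := gzPowWAux ℓ X fuel (p / 2)
        gzMulW (p * (ℓ - 1) + 1) H H
      else gzMulW (p * (ℓ - 1) + 1) X (gzPowWAux ℓ X fuel (p - 1))

/-- See `gzPowWAux`. [cite: FitznerVanDerHofstad2016NoBLE, §5.1.1 (5.4)–(5.5) pp. 1089–1090] -/
def gzPowW (ℓ : ℕ) (X : GZ) (p : ℕ) : GZ := gzPowWAux ℓ X p p

/-- `u^p` for an `ℕ` coefficient list of length `ℓ` (full products, linear chain — the lists here are short).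
[cite: FitznerVanDerHofstad2016NoBLE, §5.1.1 (5.4)–(5.5) pp. 1089–1090] -/
def powN (ℓ : ℕ) (u : List ℕ) : ℕ → List ℕ
  | 0 => [1]
  | p + 1 => forceN (pconv ((p + 1) * (ℓ - 1) + 1) u (powN ℓ u p))

/-! ### The twisted EGF row and its power table -/

/-- The contribution of ONE Bessel order `a` to a parity-split part: the hat row
`[Mf/(k!(k+a)!)]_k` (`hatRow1`; entry `k` ↔ exponent `2k + a`) scaled by `cabs` and placed at offset
`shift = (a - off)/2` of the target list (entry `k'` ↔ exponent `2k' + off`), `K+1` entries.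
[cite: FitznerVanDerHofstad2016NoBLE, §5.1.1 (5.4)–(5.5) pp. 1089–1090] -/
def rowTerm (Mf K a shift cabs : ℕ) : List ℕ :=
  (List.replicate shift 0 ++ smulN cabs (hatRow1 Mf a K)).take (K + 1)

/-- The signed contribution of order index `j` (order `a = j·m`, weight `ε_j Q_j`, unit `i^j`):
as a `GZ` with the term in the real part (`j` even, sign `(-1)^{j/2}`) or the imaginary part (`j` odd,
sign `(-1)^{(j-1)/2}`). [cite: FitznerVanDerHofstad2016NoBLE, §5.1.1 (5.4)–(5.5) pp. 1089–1090] -/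
def rowTermGZ (Mf K σ m : ℕ) (Q : ℕ → ℤ) (j : ℕ) : GZ :=
  let a := j * m
  let cabs := (if j = 0 then 1 else 2) * (Q j).natAbs
  let neg : Bool := xor (decide (Q j < 0)) (decide (2 ≤ j % 4))
  let z := List.replicate (K + 1) 0
  if j % 2 = 0 then
    let t := rowTerm Mf K a (a / 2) cabs
    (bif neg then (z, t) else (t, z), (z, z))
  else
    let t := rowTerm Mf K a ((a - σ) / 2) cabs
    ((z, z), bif neg then (z, t) else (t, z))

/-- Sum of Gaussian lists. [cite: FitznerVanDerHofstad2016NoBLE, §5.1.1 (5.4)–(5.5) pp. 1089–1090] -/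
def gzAdd (X Y : GZ) : GZ := (addPN X.1 Y.1, addPN X.2 Y.2)

/-- `gzSum f n = Σ_{j<n} f j` (structural). [cite: FitznerVanDerHofstad2016NoBLE, §5.1.1 (5.4)–(5.5) pp. 1089–1090] -/
def gzSum (f : ℕ → GZ) : ℕ → GZ → GZ
  | 0, acc => acc
  | n + 1, acc => gzSum f n (gzAdd (f n) acc)

/-- **The twisted EGF row** `Θ_1`: real part entry `k` = `Mf · Re τ_1(2k)/(2k)!`, imaginary part entry
`k` = `Mf · Im τ_1(2k+σ)/(2k+σ)!`, `τ_1(N) = Σ_{j ≤ J} ε_j i^j Q_j walk1 N (jm)`, normalised.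
[cite: FitznerVanDerHofstad2016NoBLE, §5.1.1 (5.4)–(5.5) pp. 1089–1090] -/
def gzRow (Mf K σ m J : ℕ) (Q : ℕ → ℤ) : GZ :=
  let z := zeroPN (K + 1)
  let s := gzSum (rowTermGZ Mf K σ m Q) (J + 1) (z, z)
  (forcePN (normPN s.1), forcePN (normPN s.2))

/-- **The power table** `Θ_D = Θ_1^D` (real part entry `k` = `(Mf/(2k)!) qden^D Re τ_D(2k)`).
[cite: FitznerVanDerHofstad2016NoBLE, §5.1.1 (5.4)–(5.5) pp. 1089–1090] -/
def gzTable (Mf K σ m J : ℕ) (Q : ℕ → ℤ) (D : ℕ) : GZ := gzPow σ Mf (K + 1) (gzRow Mf K σ m J Q) D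

/-! ### The `[T,∞)` layer: the complex main polynomial and the error majorant -/

/-- The MAIN-TERM coefficient list of `√(2πu) q_u(a)` in `w = 1/u` (no `ε` slot value):
`[mcoef a J i | i < blen a J]`. [cite: FitznerVanDerHofstad2016NoBLE, §5.1.1 (5.4)–(5.5) pp. 1089–1090] -/
def midList (a J : ℕ) : List ℚ := (List.range (blen a J)).map (mcoef a J)

/-- `midList` as a `2^S`-scaled integer list, padded with zeros to length `ℓ`.
[cite: FitznerVanDerHofstad2016NoBLE, §5.1.1 (5.4)–(5.5) pp. 1089–1090] -/
def midListZ (a J S ℓ : ℕ) : List ℤ := ((midList a J).map (scaleZ S)) ++ List.replicate (ℓ - blen a J) 0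

/-- The signed, scaled contribution `ε_j Q_j · 2^S Mid_{jm}` of order index `j` to `2^S qden P(w)`, as a
`GZ` (real part for `j` even with sign `(-1)^{j/2}`, imaginary part for `j` odd with sign `(-1)^{(j-1)/2}`).
[cite: FitznerVanDerHofstad2016NoBLE, §5.1.1 (5.4)–(5.5) pp. 1089–1090] -/
def wTermGZ (Jb S ℓ m : ℕ) (Q : ℕ → ℤ) (j : ℕ) : GZ :=
  let a := j * m
  let cabs := (if j = 0 then 1 else 2) * (Q j).natAbs
  let neg : Bool := xor (decide (Q j < 0)) (decide (2 ≤ j % 4))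
  let base := smulPN cabs (pnOfZ (midListZ a Jb S ℓ))
  let t := bif neg then negPN base else base
  let z := zeroPN ℓ
  if j % 2 = 0 then (t, z) else (z, t)

/-- **`2^S · qden · P(w)`** as a Gaussian coefficient list of length `ℓ` (normalised).
[cite: FitznerVanDerHofstad2016NoBLE, §5.1.1 (5.4)–(5.5) pp. 1089–1090] -/
def gzP (Jb S ℓ m J : ℕ) (Q : ℕ → ℤ) : GZ :=
  let z := zeroPN ℓ
  let s := gzSum (wTermGZ Jb S ℓ m Q) (J + 1) (z, z)
  (forcePN (normPN s.1), forcePN (normPN s.2))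

/-- The scaled majorant base lists `2^{2S}(α U_0(w) + c ρ w^{J_b+1})` (`c = 1, 2`), length `ℓ`, for dyadic
`α, ρ` (scale `S`) and the dyadic upper bracket list `upList 0 J_b (eps 0)`; entries as `ℕ` via `Int.toNat`
(the certificate checks that nothing is negative). [cite: FitznerVanDerHofstad2016NoBLE, §5.1.1 (5.4)–(5.5) pp. 1089–1090] -/
def majBase (Jb S ℓ : ℕ) (eps0 α ρ : ℚ) (c : ℕ) : List ℕ :=
  (List.range ℓ).map fun i =>
    ((scaleZ S α) * (scaleZ S ((upList 0 Jb eps0).getD i 0))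
      + (if i = Jb + 1 then (c : ℤ) * (scaleZ S ρ) * 2 ^ S else 0)).toNat

/-! ### Certificates -/

/-- The data of a twisted seed certificate for the axis row of Bessel orders `j·m`, `j ≤ J`, with the
literal weights `q_j = Q j / qden`: cut-off `T = t²`, bracket order `Jb`, cut point `s₀`, half-table
length `K+1` (hat base `M̂ = 2K+1`), Poisson truncation `M n` per seed index `n = 1..4`, bracket-constant
majorants `eps a` per order, dyadic scale `S`, `expPartial` length `nexp`, `sLo ≤ √(2π) ≤ sHi`, the
majorant constants `alpha ≥ Σ ε_j |q_j|`, `rho ≥ Σ ε_j |q_j| eps (jm)`, the target intervals `[lo n, hi n]`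
and the INTERMEDIATE brackets `pLo n ≤ P_n ≤ pHi n`, `uLo n ≤ U_n ≤ uHi n` (Poisson layer),
`imLo n ≤ IM_n ≤ imHi n`, `IB_n ≤ ibHi n` (tail layer). [cite: FitznerVanDerHofstad2016NoBLE, §5.1.1 (5.4)–(5.5) pp. 1089–1090] -/
structure TwCert where
  m : ℕ
  J : ℕ
  Q : ℕ → ℤ
  qden : ℕ
  t : ℕ
  Jb : ℕ
  s0 : ℚ
  K : ℕ
  M : ℕ → ℕ
  eps : ℕ → ℚ
  S : ℕ
  nexp : ℕ
  sLo : ℚ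
  sHi : ℚ
  alpha : ℚ
  rho : ℚ
  lo : ℕ → ℚ
  hi : ℕ → ℚ
  pLo : ℕ → ℚ
  pHi : ℕ → ℚ
  uLo : ℕ → ℚ
  uHi : ℕ → ℚ
  imLo : ℕ → ℚ
  imHi : ℕ → ℚ
  ibHi : ℕ → ℚ

/-- The Horner base `(2D)²`. [cite: FitznerVanDerHofstad2016NoBLE, §5.1.1 (5.4)–(5.5) pp. 1089–1090] -/
def baseT (D : ℕ) : ℕ := (2 * D) ^ 2

namespace TwCert

variable (c : TwCert) (D : ℕ)

/-- `M̂ = 2K + 1`. [cite: FitznerVanDerHofstad2016NoBLE, §5.1.1 (5.4)–(5.5) pp. 1089–1090] -/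
def Mh : ℕ := 2 * c.K + 1

/-- `σ = m mod 2` (the parity class carrying the imaginary part). [cite: FitznerVanDerHofstad2016NoBLE, §5.1.1 (5.4)–(5.5) pp. 1089–1090] -/
def sigma : ℕ := c.m % 2

/-- `λ = D·T = D t²`. [cite: FitznerVanDerHofstad2016NoBLE, §5.1.1 (5.4)–(5.5) pp. 1089–1090] -/
def lamT : ℕ := D * c.t ^ 2

/-- The Bessel orders `[0, m, 2m, …, Jm]`. [cite: FitznerVanDerHofstad2016NoBLE, §5.1.1 (5.4)–(5.5) pp. 1089–1090] -/
def orders : List ℕ := (List.range (c.J + 1)).map (· * c.m)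

/-- `ε_j |Q_j|` (`ε_0 = 1`, `ε_j = 2`). [cite: FitznerVanDerHofstad2016NoBLE, §5.1.1 (5.4)–(5.5) pp. 1089–1090] -/
def wabs (j : ℕ) : ℕ := (if j = 0 then 1 else 2) * (c.Q j).natAbs

/-- The real part `(pos, neg)` of the power table `Θ_D` (entry `k` = `(M̂!/(2k)!) qden^D Re τ_D(2k)`).
[cite: FitznerVanDerHofstad2016NoBLE, §5.1.1 (5.4)–(5.5) pp. 1089–1090] -/
def tableRe : List ℕ × List ℕ := (gzTable (prodRange 0 c.Mh) c.K c.sigma c.m c.J c.Q D).1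

/-- Number of half-indices `k` with `2k < M n`. [cite: FitznerVanDerHofstad2016NoBLE, §5.1.1 (5.4)–(5.5) pp. 1089–1090] -/
def cnt (n : ℕ) : ℕ := (c.M n + 1) / 2


/-- The common denominator `n'! · M̂! · (2D)^{2K} · qden^D` of `P_n` and `U_n` (`n' = n - 1`).
[cite: FitznerVanDerHofstad2016NoBLE, §5.1.1 (5.4)–(5.5) pp. 1089–1090] -/
def denT (n : ℕ) : ℚ :=
  ((n - 1).factorial : ℚ) * (prodRange 0 c.Mh : ℚ) * (((2 * D : ℕ) : ℚ)) ^ (2 * c.K) * (c.qden : ℚ) ^ D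

/-- Horner numerator over one `ℕ` part `w` of the real table with the factorial sequence:
`((2D)²)^{K+1-cnt n} · Σ_{k<cnt n} w_k (2k+n')! ((2D)²)^{cnt n-1-k}`. [cite: FitznerVanDerHofstad2016NoBLE, §5.1.1 (5.4)–(5.5) pp. 1089–1090] -/
def NPT (w : List ℕ) (n : ℕ) : ℕ :=
  baseT D ^ (c.K + 1 - c.cnt n) * hornerB (baseT D) w (facSeq (n - 1) (c.cnt n))

/-- Horner numerator with the exponential sequence `A_{2k+n'}` (`A_j = Σ_{i≤j} λ^i j!/i!`).
[cite: FitznerVanDerHofstad2016NoBLE, §5.1.1 (5.4)–(5.5) pp. 1089–1090] -/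
def NUT (w : List ℕ) (n : ℕ) : ℕ :=
  baseT D ^ (c.K + 1 - c.cnt n) * hornerB (baseT D) w (expSeq (c.lamT D) (n - 1) (c.cnt n))

/-- `P_n = Σ_{N < M n} C(N+n', n') Re t_N/(2D)^N` exactly (`t_N = τ_D(N)/qden^D`; `re` = the real table).
[cite: FitznerVanDerHofstad2016NoBLE, §5.1.1 (5.4)–(5.5) pp. 1089–1090] -/
def PqT (re : List ℕ × List ℕ) (n : ℕ) : ℚ := ((c.NPT D re.1 n : ℚ) - (c.NPT D re.2 n : ℚ)) / c.denT D n

/-- `U_n = Σ_{N < M n} C(N+n',n') (Re t_N/(2D)^N) A_{N+n'}/(N+n')!`, so that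
`e^{-λ} U_n = Σ C(N+n',n') (Re t_N/(2D)^N) · e^{-λ}E_{N+n'+1}(λ)`. [cite: FitznerVanDerHofstad2016NoBLE, §5.1.1 (5.4)–(5.5) pp. 1089–1090] -/
def UqT (re : List ℕ × List ℕ) (n : ℕ) : ℚ := ((c.NUT D re.1 n : ℚ) - (c.NUT D re.2 n : ℚ)) / c.denT D n

/-- `r⁻ = expNegOneLo^λ ≤ e^{-λ}`. [cite: FitznerVanDerHofstad2016NoBLE, §5.1.1 (5.4)–(5.5) pp. 1089–1090] -/
def rLoT : ℚ := expNegOneLo ^ c.lamT D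

/-- `e^{-λ} ≤ r⁺ = expNegOneHi^λ`. [cite: FitznerVanDerHofstad2016NoBLE, §5.1.1 (5.4)–(5.5) pp. 1089–1090] -/
def rHiT : ℚ := expNegOneHi ^ c.lamT D

/-- The majorant `R⁺_n` of the two-sided Poisson-tail remainder `|Σ_{N ≥ M} C(N+n',n') (Re t_N/(2D)^N) Q(λ, N+n'+1)|`:
`r⁺ · θ · θ' · λ^{M+n'+1} / (n'! · M! · (M+n'+1))` (as `Cert.RplusD`). [cite: FitznerVanDerHofstad2016NoBLE, §5.1.1 (5.4)–(5.5) pp. 1089–1090] -/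
def RplusT (n : ℕ) : ℚ :=
  c.rHiT D * (((c.M n + n + 1 : ℕ) : ℚ) / (((c.M n + n + 1 : ℕ) : ℚ) - (c.lamT D : ℚ))) *
    (((c.M n + 1 : ℕ) : ℚ) / (((c.M n + 1 : ℕ) : ℚ) - (c.lamT D : ℚ))) *
    (c.lamT D : ℚ) ^ (c.M n + n) / (((n - 1).factorial : ℚ) * ((c.M n).factorial : ℚ) * ((c.M n + n : ℕ) : ℚ))

/-- `κ⁻ = 1/sHi^D ≤ (2π)^{-D/2}`. [cite: FitznerVanDerHofstad2016NoBLE, §5.1.1 (5.4)–(5.5) pp. 1089–1090] -/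
def kLoT : ℚ := 1 / c.sHi ^ D

/-- `(2π)^{-D/2} ≤ κ⁺ = 1/sLo^D`. [cite: FitznerVanDerHofstad2016NoBLE, §5.1.1 (5.4)–(5.5) pp. 1089–1090] -/
def kHiT : ℚ := 1 / c.sLo ^ D

/-- `h = 1/T`. [cite: FitznerVanDerHofstad2016NoBLE, §5.1.1 (5.4)–(5.5) pp. 1089–1090] -/
def h : ℚ := 1 / (c.t : ℚ) ^ 2

/-- Length of the `w`-coefficient lists of `P` (the largest order has the longest bracket list).
[cite: FitznerVanDerHofstad2016NoBLE, §5.1.1 (5.4)–(5.5) pp. 1089–1090] -/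
def lw : ℕ := blen (c.J * c.m) c.Jb

/-- `2^S qden P(w)` as a Gaussian coefficient list. [cite: FitznerVanDerHofstad2016NoBLE, §5.1.1 (5.4)–(5.5) pp. 1089–1090] -/
def gzPw : GZ := gzP c.Jb c.S c.lw c.m c.J c.Q

/-- The real part `(pos, neg)` of `(2^S qden)^D P(w)^D`. [cite: FitznerVanDerHofstad2016NoBLE, §5.1.1 (5.4)–(5.5) pp. 1089–1090] -/
def powRe : List ℕ × List ℕ := (gzPowW c.lw c.gzPw D).1

/-- The scale `(2^S qden)^D` of `powRe`. [cite: FitznerVanDerHofstad2016NoBLE, §5.1.1 (5.4)–(5.5) pp. 1089–1090] -/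
def scaleP : ℚ := ((2 : ℚ) ^ c.S * (c.qden : ℚ)) ^ D

/-- `IM_n = ∫_T^∞ u^{n-1-D/2} Re P(1/u)^D du` (exact, termwise). [cite: FitznerVanDerHofstad2016NoBLE, §5.1.1 (5.4)–(5.5) pp. 1089–1090] -/
def IM (pr : List ℕ × List ℕ) (n : ℕ) : ℚ := tailInt c.t pr (D - 2 * n) / c.scaleP D

/-- Length of the majorant base lists (`J_b + 2`). [cite: FitznerVanDerHofstad2016NoBLE, §5.1.1 (5.4)–(5.5) pp. 1089–1090] -/
def lg : ℕ := blen 0 c.Jb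

/-- `2^{2S}(α U_0 + ρ w^{J_b+1})` and `2^{2S}(α U_0 + 2ρ w^{J_b+1})`. [cite: FitznerVanDerHofstad2016NoBLE, §5.1.1 (5.4)–(5.5) pp. 1089–1090] -/
def g1 : List ℕ := majBase c.Jb c.S c.lg (c.eps 0) c.alpha c.rho 1

/-- See `g1`. [cite: FitznerVanDerHofstad2016NoBLE, §5.1.1 (5.4)–(5.5) pp. 1089–1090] -/
def g2 : List ℕ := majBase c.Jb c.S c.lg (c.eps 0) c.alpha c.rho 2

/-- The scale `2^{2SD}` of the majorant powers. [cite: FitznerVanDerHofstad2016NoBLE, §5.1.1 (5.4)–(5.5) pp. 1089–1090] -/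
def scaleG : ℚ := ((2 : ℚ) ^ (2 * c.S)) ^ D

/-- `IB_n = ∫_T^∞ u^{n-1-D/2} B(1/u) du`, `B = G_2^D - G_1^D` (exact, termwise; nonnegative).
[cite: FitznerVanDerHofstad2016NoBLE, §5.1.1 (5.4)–(5.5) pp. 1089–1090] -/
def IB (gg : List ℕ × List ℕ) (n : ℕ) : ℚ := tailInt c.t gg (D - 2 * n) / c.scaleG D

/-- Upper bound of `e^{-λ} U_n` from the brackets (sign-aware). [cite: FitznerVanDerHofstad2016NoBLE, §5.1.1 (5.4)–(5.5) pp. 1089–1090] -/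
def eUB (n : ℕ) : ℚ := if 0 ≤ c.uHi n then c.rHiT D * c.uHi n else c.rLoT D * c.uHi n

/-- Lower bound of `e^{-λ} U_n` from the brackets (sign-aware). [cite: FitznerVanDerHofstad2016NoBLE, §5.1.1 (5.4)–(5.5) pp. 1089–1090] -/
def eLB (n : ℕ) : ℚ := if 0 ≤ c.uLo n then c.rLoT D * c.uLo n else c.rHiT D * c.uLo n

/-- Lower bound of the `[T,∞)` block `κ (IM + θ IB)` divided by the prefactor (sign-aware in `κ`).
[cite: FitznerVanDerHofstad2016NoBLE, §5.1.1 (5.4)–(5.5) pp. 1089–1090] -/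
def tailLo (n : ℕ) : ℚ :=
  let r := c.imLo n - c.ibHi n
  if 0 ≤ r then c.kLoT D * r else c.kHiT D * r

/-- Upper bound of the `[T,∞)` block divided by the prefactor (sign-aware in `κ`).
[cite: FitznerVanDerHofstad2016NoBLE, §5.1.1 (5.4)–(5.5) pp. 1089–1090] -/
def tailHi (n : ℕ) : ℚ :=
  let s := c.imHi n + c.ibHi n
  if 0 ≤ s then c.kHiT D * s else c.kLoT D * s

/-- The certified LOWER bound of `RowObj`, assembled from the intermediate brackets.
[cite: FitznerVanDerHofstad2016NoBLE, §5.1.1 (5.4)–(5.5) pp. 1089–1090] -/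
def loFinalT (n : ℕ) : ℚ := c.pLo n - c.eUB D n - c.RplusT D n + Cert.prefD D n * c.tailLo D n

/-- The certified UPPER bound of `RowObj`, assembled from the intermediate brackets.
[cite: FitznerVanDerHofstad2016NoBLE, §5.1.1 (5.4)–(5.5) pp. 1089–1090] -/
def hiFinalT (n : ℕ) : ℚ := c.pHi n - c.eLB D n + c.RplusT D n + Cert.prefD D n * c.tailHi D n

/-- `Σ_{j ≤ J} ε_j |Q_j|` (numerator of `Σ ε_j |q_j|`). [cite: FitznerVanDerHofstad2016NoBLE, §5.1.1 (5.4)–(5.5) pp. 1089–1090] -/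
def wabsSum : ℕ := ((List.range (c.J + 1)).map c.wabs).sum

/-- `Σ_{j ≤ J} ε_j |Q_j| eps (jm)` (numerator of `Σ ε_j |q_j| ε_{jm}`). [cite: FitznerVanDerHofstad2016NoBLE, §5.1.1 (5.4)–(5.5) pp. 1089–1090] -/
def wepsSum : ℚ := ((List.range (c.J + 1)).map fun j => (c.wabs j : ℚ) * c.eps (j * c.m)).sum

/-- Parameter sanity: `0 < s₀ < 1`, `(J_b + 3/2)/(2 s₀²) ≤ T`, `0 < t`, `0 < m`, `9 ≤ D`, `0 < qden`,
`|Q_j| ≤ qden`, `√(2π)` brackets, per order the bracket constant and the dyadic integrality of the main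
coefficients, the order-`0` upper list nonnegative and dyadic, `α, ρ` dyadic with `Σ ε_j|q_j| ≤ α`,
`Σ ε_j |q_j| ε_{jm} ≤ ρ`, the majorant base lists free of negative entries; per seed index
`λ + 1 < M n ≤ 2K + 2` and `cnt n ≤ K + 1`. (Kernel cost: seconds.) [cite: FitznerVanDerHofstad2016NoBLE, §5.1.1 (5.4)–(5.5) pp. 1089–1090] -/
def paramsOKT : Bool :=
  decide (0 < c.s0) && decide (c.s0 < 1) && decide (((c.Jb : ℚ) + 3 / 2) / (2 * c.s0 ^ 2) ≤ (c.t : ℚ) ^ 2) &&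
  decide (0 < c.t) && decide (0 < c.m) && decide (9 ≤ D) && decide (0 < c.qden) && decide (0 < c.nexp) &&
  decide (0 < c.sLo) && decide (c.sLo ^ 2 ≤ 2 * piLo) && decide (0 < c.sHi) && decide (2 * piHi ≤ c.sHi ^ 2) &&
  decide (0 ≤ expNegOneLo) &&
  (List.range (c.J + 1)).all (fun j => decide ((c.Q j).natAbs ≤ c.qden)) &&
  c.orders.all (fun a =>
    decide (0 ≤ c.eps a) &&
    decide (epsBoundQ a c.Jb c.s0 c.t c.sHi c.nexp ≤ c.eps a) &&
    (midList a c.Jb).all (dyadicOK c.S)) &&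
  decide (0 ≤ c.eps 0) && decide (epsBoundQ 0 c.Jb c.s0 c.t c.sHi c.nexp ≤ c.eps 0) &&
  (upList 0 c.Jb (c.eps 0)).all (fun x => dyadicOK c.S x && decide (0 ≤ x)) &&
  dyadicOK c.S c.alpha && dyadicOK c.S c.rho && decide (0 ≤ c.rho) &&
  decide ((c.wabsSum : ℚ) ≤ c.alpha * c.qden) && decide (c.wepsSum ≤ c.rho * c.qden) &&
  (List.range 4).all (fun i =>
    decide (1 ≤ c.M (i + 1)) && decide (c.M (i + 1) ≤ 2 * c.K + 2) && decide (c.cnt (i + 1) ≤ c.K + 1) &&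
    decide (c.lamT D + 1 < c.M (i + 1)))

/-- **Poisson layer check**: the exact `P_n`, `U_n` (from the kernel-evaluated power table) lie in the
generator's brackets. (Kernel cost: the table.) [cite: FitznerVanDerHofstad2016NoBLE, §5.1.1 (5.4)–(5.5) pp. 1089–1090] -/
def poissonCheckT : Bool :=
  let re := c.tableRe D
  (List.range 4).all fun i =>
    decide (c.pLo (i + 1) ≤ c.PqT D re (i + 1)) && decide (c.PqT D re (i + 1) ≤ c.pHi (i + 1)) &&
    decide (c.uLo (i + 1) ≤ c.UqT D re (i + 1)) && decide (c.UqT D re (i + 1) ≤ c.uHi (i + 1))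

/-- **Tail layer check**: `imLo n ≤ IM_n ≤ imHi n` and `IB_n ≤ ibHi n` for the kernel-evaluated powers.
(Kernel cost: the powers.) [cite: FitznerVanDerHofstad2016NoBLE, §5.1.1 (5.4)–(5.5) pp. 1089–1090] -/
def tailCheckT : Bool :=
  let pr := c.powRe D
  let gg := (powN c.lg c.g2 D, powN c.lg c.g1 D)
  (List.range 4).all fun i =>
    decide (c.imLo (i + 1) ≤ c.IM D pr (i + 1)) && decide (c.IM D pr (i + 1) ≤ c.imHi (i + 1)) &&
    decide (c.IB D gg (i + 1) ≤ c.ibHi (i + 1))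

/-- **Final check**: `0 ≤ ibHi n` and the assembled bounds sit inside the target interval.
(Kernel cost: seconds.) [cite: FitznerVanDerHofstad2016NoBLE, §5.1.1 (5.4)–(5.5) pp. 1089–1090] -/
def finalCheckT : Bool :=
  (List.range 4).all fun i =>
    decide (0 ≤ c.ibHi (i + 1)) &&
    decide (c.lo (i + 1) ≤ c.loFinalT D (i + 1)) && decide (c.hiFinalT D (i + 1) ≤ c.hi (i + 1))

/-- **The certificate check** (the conjunction; an instance file proves the four conjuncts as separate
`decide +kernel` theorems). [cite: FitznerVanDerHofstad2016NoBLE, §5.1.1 (5.4)–(5.5) pp. 1089–1090] -/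
def checkT : Bool := c.paramsOKT D && c.finalCheckT D && c.poissonCheckT D && c.tailCheckT D

end TwCert

end Literature.Probability.FitznerVanDerHofstad2017.SeedCert
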